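import Summits.RiemannHypothesis.RiemannHypothesis.Theorems.SignConeExactConeRigidityCompact
import Summits.RiemannHypothesis.RiemannHypothesis.Theorems.SignConeExactConeRigidityKRH

/-!
# Route SignCone, item `ExactConeRigidity` (stmt-RiemannHypothesis-16306): the exact chain, end to end,
modulo the one-sided abscissa theorem

The 2001 exact chain for `ExactConeRigidity` — exact sign-cone inequality at every cutoff ⇒ RH — is
DUALITY (`signCone_conicDuality 0`, landed) → COMPACTNESS (`exists_weight_allCutoffs`, landed) → STRUCTURE
(`exactWeight_continuation`: translate-boundedness, `Σ c(n) n^{-σ} < ∞`, continuation of `L_c - 1/(s-1)`; landed)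
→ ONE-SIDED ABSCISSA (deficit `Σ_p (log p - c(p))₊ p^{-σ} < ∞` or surplus `Σ_n (c(n) - Λ(n))₊ n^{-σ} < ∞`,
`σ > 1/2`: W-MAG Thm 1.2(i) at zero slack / fefr Thm B — NOT in the tree, unpublished) → LANDAU TRANSFER
(`stub_transfer`, `riemannHypothesis_of_fakeWeight_landau_surplus`; landed).

* `ExactConeRigidity_of_exactPrimeDeficit` — the route item from the exact prime-deficit theorem;
* `ExactConeRigidity_of_exactSurplus` — the route item from the exact surplus theorem.

So the item is now EXACTLY the one-sided abscissa theorem for exact-cone weights (either side). (This module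
imports both former "import worlds" of the route — possible since the duplicate `def WeilWindowSimpleEven` was
removed from `WeilGroundStateRealZeros.lean`, p131025.)
-/

noncomputable section

-- `Summit.RiemannHypothesis.RiemannHypothesis.…` repeats a namespace component by design (D-0017 layout).
set_option linter.dupNamespace false

open scoped BigOperators ArithmeticFunction.vonMangoldt Real
open Complex MeasureTheory Set Filter LSeries

namespace Summit.RiemannHypothesis.RiemannHypothesis.Theorems.SignConeExactConeRigidity

open Literature.NumberTheory.LFunctions

/-- From the hypothesis of `ExactConeRigidity` (exact sign-cone inequality at every cutoff): ONE weight
`c ≥ 0`, `c 1 = 0`, exact-feasible against EVERY Weil test (duality at each cutoff, `signCone_conicDuality 0`,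
then compactness, `exists_weight_allCutoffs`; every Weil test lives in some window). -/
theorem exists_exactWeight_of_exactSignCone
    (hexact : ∀ a : ℝ, 0 < a → ∀ (k : ℕ) (g : Fin k → ℝ → ℂ),
      (∀ i, (ContDiff ℝ ((⊤ : ℕ∞) : WithTop ℕ∞) (g i) ∧ HasCompactSupport (g i)) ∧ tsupport (g i) ⊆ Set.Icc (-a) a) →
      let F : ℝ → ℂ := fun t => ∑ i, MeasureTheory.convolution (g i) (fun u => (starRingEnd ℂ) ((g i) (-u)))
        (ContinuousLinearMap.mul ℂ ℂ) MeasureTheory.MeasureSpace.volume t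
      (∀ n : ℕ, 2 ≤ n → 0 ≤ (F (Real.log n)).re) →
      let M : ℂ → ℂ := fun s => ∫ u : ℝ, F u * Complex.exp ((s - 1 / 2) * u)
      0 ≤ (M 0 + M 1 + ((1 / (2 * Real.pi) : ℂ) * (∫ t : ℝ, M (1 / 2 + t * Complex.I) *
        ((Complex.digamma (1 / 4 + t / 2 * Complex.I)).re : ℂ)) - F 0 * (Real.log Real.pi : ℂ))).re) :
    ∃ c : ℕ → ℝ, (∀ n, 0 ≤ c n) ∧ c 1 = 0 ∧ ∀ g : ℝ → ℂ, IsWeilTest g →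
      0 ≤ (weilPolarTerm (weilConv g (weilReflect g)) + weilArchTerm (weilConv g (weilReflect g)) -
          ∑' n : ℕ, ((c n : ℝ) : ℂ) / (Real.sqrt n : ℂ) *
            (weilConv g (weilReflect g) (Real.log n) + weilConv g (weilReflect g) (-Real.log n))).re := by
  -- duality at each cutoff (`κ = 0`)
  have hK : ∀ a : ℝ, 0 < a → ∃ c : ℕ → ℝ, (∀ n, 0 ≤ c n) ∧ c 1 = 0 ∧
      ∀ g : ℝ → ℂ, IsWeilTest g → tsupport g ⊆ Icc (-a) a →
        0 ≤ (weilPolarTerm (weilConv g (weilReflect g)) +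
          weilArchTerm (weilConv g (weilReflect g)) -
          ∑' n : ℕ, ((c n : ℝ) : ℂ) / (Real.sqrt n : ℂ) *
            (weilConv g (weilReflect g) (Real.log n) +
              weilConv g (weilReflect g) (-Real.log n))).re := by
    intro a ha
    obtain ⟨c, hc0, hc1, hc⟩ := signCone_conicDuality 0 ha (fun k g hg hnodes ↦ by
      rw [zero_mul, neg_zero]
      exact hexact a ha k g hg hnodes)
    refine ⟨c, hc0, hc1, fun g hg hsupp ↦ ?_⟩
    have h := hc g hg hsupp
    rwa [zero_mul, neg_zero] at h
  -- compactness: one weight for all cutoffs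
  obtain ⟨c, hc0, hc1, hcK⟩ := exists_weight_allCutoffs hK
  refine ⟨c, hc0, hc1, fun g hg => ?_⟩
  -- every Weil test lives in some window
  obtain ⟨R, hR⟩ := hg.2.isCompact.isBounded.subset_closedBall 0
  set a : ℝ := max R 1 with ha_def
  have ha : 0 < a := lt_of_lt_of_le zero_lt_one (le_max_right _ _)
  have hsupp : tsupport g ⊆ Icc (-a) a := by
    refine hR.trans ?_
    rw [Real.closedBall_eq_Icc, zero_sub, zero_add]
    exact Icc_subset_Icc (neg_le_neg (le_max_left _ _)) (le_max_left _ _)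
  exact hcK a ha g hg hsupp

/-- **`ExactConeRigidity` from the exact prime-deficit theorem.** If every weight `c ≥ 0`, `c 1 = 0`, that is
exact-feasible against every Weil test (with the automatic analytic package: `Σ c(n) n^{-σ} < ∞` for `σ > 1`
and the local continuation of `L_c - 1/(s-1)` to `Re s > 1/2`) has `Σ_p (log p - c(p))₊ p^{-σ} < ∞` for every
`σ > 1/2` (W-MAG Thm 1.2(i) at zero slack), then the route item `ExactConeRigidity` holds. -/
theorem ExactConeRigidity_of_exactPrimeDeficit
    (hD : ∀ c : ℕ → ℝ, (∀ n, 0 ≤ c n) → c 1 = 0 →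
      (∀ φ : ℝ → ℂ, IsWeilTest φ →
        0 ≤ (weilPolarTerm (weilConv φ (weilReflect φ)) + weilArchTerm (weilConv φ (weilReflect φ)) -
            ∑' n : ℕ, ((c n : ℝ) : ℂ) / (Real.sqrt n : ℂ) *
              (weilConv φ (weilReflect φ) (Real.log n) + weilConv φ (weilReflect φ) (-Real.log n))).re) →
      (∀ σ : ℝ, 1 < σ → LSeriesSummable (fun n => ((c n : ℝ) : ℂ)) σ) →
      (∀ s₀ : ℂ, 1 / 2 < s₀.re → ∃ η : ℝ, 0 < η ∧ ∃ F : ℂ → ℂ,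
        DifferentiableOn ℂ F {s : ℂ | 1 / 2 < s.re ∧ s.re < s₀.re + 1 ∧ s₀.im - η < s.im ∧ s.im < s₀.im + η} ∧
        ∀ s ∈ {s : ℂ | 1 / 2 < s.re ∧ s.re < s₀.re + 1 ∧ s₀.im - η < s.im ∧ s.im < s₀.im + η},
          1 < s.re → F s = LSeries (fun n => ((c n : ℝ) : ℂ)) s - 1 / (s - 1)) →
      ∀ σ : ℝ, 1 / 2 < σ →
        Summable (fun p : ℕ => if p.Prime then max (Real.log p - c p) 0 / (p : ℝ) ^ σ else 0)) :
    Theses.SignCone.ExactConeRigidity := by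
  intro hexact
  obtain ⟨c, hc0, hc1, hU0⟩ := exists_exactWeight_of_exactSignCone hexact
  exact riemannHypothesis_of_exactWeight_of_primeDeficit hD hc0 hc1 hU0

/-- **`ExactConeRigidity` from the exact surplus theorem** (archive fefr Thm B, surplus side): if every weight
`c ≥ 0`, `c 1 = 0`, exact-feasible against every Weil test (with its automatic analytic package) has
`Σ_n (c(n) - Λ(n))₊ n^{-σ} < ∞` for every `σ > 1/2`, then the route item `ExactConeRigidity` holds. -/
theorem ExactConeRigidity_of_exactSurplus
    (hS : ∀ c : ℕ → ℝ, (∀ n, 0 ≤ c n) → c 1 = 0 →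
      (∀ φ : ℝ → ℂ, IsWeilTest φ →
        0 ≤ (weilPolarTerm (weilConv φ (weilReflect φ)) + weilArchTerm (weilConv φ (weilReflect φ)) -
            ∑' n : ℕ, ((c n : ℝ) : ℂ) / (Real.sqrt n : ℂ) *
              (weilConv φ (weilReflect φ) (Real.log n) + weilConv φ (weilReflect φ) (-Real.log n))).re) →
      (∀ σ : ℝ, 1 < σ → LSeriesSummable (fun n => ((c n : ℝ) : ℂ)) σ) →
      (∀ s₀ : ℂ, 1 / 2 < s₀.re → ∃ η : ℝ, 0 < η ∧ ∃ F : ℂ → ℂ,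
        DifferentiableOn ℂ F {s : ℂ | 1 / 2 < s.re ∧ s.re < s₀.re + 1 ∧ s₀.im - η < s.im ∧ s.im < s₀.im + η} ∧
        ∀ s ∈ {s : ℂ | 1 / 2 < s.re ∧ s.re < s₀.re + 1 ∧ s₀.im - η < s.im ∧ s.im < s₀.im + η},
          1 < s.re → F s = LSeries (fun n => ((c n : ℝ) : ℂ)) s - 1 / (s - 1)) →
      ∀ σ : ℝ, 1 / 2 < σ → LSeriesSummable (fun n => ((max (c n - Λ n) 0 : ℝ) : ℂ)) σ) :
    Theses.SignCone.ExactConeRigidity := by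
  intro hexact
  obtain ⟨c, hc0, hc1, hU0⟩ := exists_exactWeight_of_exactSignCone hexact
  exact riemannHypothesis_of_exactWeight_of_surplus hS hc0 hc1 hU0

end Summit.RiemannHypothesis.RiemannHypothesis.Theorems.SignConeExactConeRigidity
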